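import Summits.BirchSwinnertonDyer.BirchSwinnertonDyer.Theorems.EisensteinPrimesTwoVariableKatzBranchSupply
import Summits.BirchSwinnertonDyer.Rank1Residual.X11b.Three.LambdaSupplyTwistFamily
import Literature.NumberTheory.EllipticCurves.CastellaGrossiLeeSkinner2022.KatzPAdicLFunctionFrame
import Literature.NumberTheory.EllipticCurves.HeckeGrossencharakterFunctionalEquation
import Literature.NumberTheory.EllipticCurves.Hsieh2012.NonvanishingHeckeLValuesModPContinuationProofs
import Literature.NumberTheory.EllipticCurves.HeegnerPointsKolyvaginCebotarevProofs
import HarnessLib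

/-!
# The de Shalit ↔ CGLS dictionary on the anticyclotomic line: the `L`-value identity and THE FACTOR
# (helper file for crux 2 `GoodLatticeBDPValue`, stmt-BirchSwinnertonDyer-19032, line `halves`,
# stub 3 `stub_anDS` piece AN-F₁ `KatzLineIntFrameAt` of `Cruxes/GoodLatticeBDPValue/Lines/halves_anDS_split_idea11g4.lean`;
# seat `bsd-line-x1-p1-w2` gen 2)

The CGLS frame `CastellaGrossiLeeSkinner2022.IsKatzLFunction ι v v̄ ∅ κ γ θ_K Ω_K Ω_p L` prescribes, at an
anticyclotomic `φ` of type `(n, −n)`, the value `ι⁻¹(katzInterpolationValue p θ_K v v̄ ∅ φ n Ω_K (L(θ_Kφ,1)))·Ω_p^{2n}`.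
The de Shalit frame `DeShalit1987.IsKatzBranch ι v v̄ S κ γ⁻¹ (reflect θ_K⁻¹) Ω δ Ω_p Q♭` of the REFLECTED twist
`reflect θ_K⁻¹ = θ_K‖·‖` (for `c`-invariant `θ_K`) prescribes, at the datum `(φ⁻¹, r⁻¹, n+1, n−1)`, the value
`ι⁻¹(interpolationValue p v v̄ S (θ_K‖·‖φ⁻¹) (n+1) (n−1) Ω δ (L(θ_K‖·‖φ⁻¹,0)))·Ω_p^{2n}`. This file proves
the two identities that make these the same number up to the constant `4·ζ^{n−1}`, `ζ = iδ/√D_K`: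

* §1 `heckeLFunction_reflect_inv_mul_inv`: `L(θ_K‖·‖φ⁻¹, s) = L(θ_Kφ, s+1)` for EVERY `s` (norm shift
  `heckeLFunction_mul_eq_of_forall_apply_eq_cpow` + conjugation invariance `heckeLFunction_galConj`, given
  `θ_K ∘ c = θ_K` and `φ ∘ c = φ⁻¹`); hence the CGLS continuation binder `hL` of `L(θ_Kφ, ·)` yields a de
  Shalit binder for `L(θ_K‖·‖φ⁻¹, ·)` and ANY such binder has `continuation 0 = hL.continuation 1`
  (identity theorem, `continuation_eq_of_differentiable`).
* §2 `galConj_complexConj_eq_inv_of_factorsThroughZp`: `φ ∘ c = φ⁻¹` for every everywhere-unramified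
  Hecke character whose `p`-adic avatar factors through an ANTICYCLOTOMIC `ℤ_p`-extension (x11b's
  `galConj_eq_inv_of_factorsThroughZp` in the `IsCMField.complexConj` currency).
* §3 the two primes above a split `p` of an imaginary quadratic field: `c • v = v̄`, `N v = N v̄ = p`.
* §4 THE FACTOR `katzInterpolationValue_eq_mul_interpolationValue`:
  `katzInterpolationValue p θ_K v v̄ ∅ φ n Ω L = 4·ζ^{n−1}·interpolationValue p v v̄ S (reflect θ_K⁻¹·φ⁻¹) (n+1) (n−1) Ω δ L`
  with `ζ = (2πi/√D_K)/(2π/δ)`, `ζ² = −δ²/D_K` (`= ∓1` for `δ² = ±D_K`), so `ζ⁴ = 1`.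

Pure bookkeeping over the tree's definitions; no fact, no definition, no `sorry`; nothing about BSD.
References: de Shalit 1987 II.4.16 (50), II.6.1 (1); CGLS 2022 Thm. 2.1.2; Kriz 2016 Thm. 27; Katz 1978 (5.3.5).
-/

-- the summit namespace `Summit.BirchSwinnertonDyer.BirchSwinnertonDyer` repeats the problem name by design (D-0017)
set_option linter.dupNamespace false
set_option autoImplicit false

noncomputable section

open scoped Classical Topology

open Filter NumberField IsDedekindDomain Field Literature.NumberTheory.EllipticCurves
  Literature.NumberTheory.GaloisRepresentations Literature.NumberTheory.GaloisRepresentations.HeckeCharacter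
  Literature.NumberTheory.Automorphic
  Literature.NumberTheory.EllipticCurves.CastellaGrossiLeeSkinner2022
  Summit.BirchSwinnertonDyer.Rank1Residual.X11b Summit.BirchSwinnertonDyer.Rank1Residual.X11b.Three.LambdaSupply

namespace Summit.BirchSwinnertonDyer.BirchSwinnertonDyer.Theorems.KatzLineFrame

/-! ## §1 The `L`-value identity `L(θ_K‖·‖φ⁻¹, s) = L(θ_Kφ, s+1)` and the continuation binders -/

section LValue

variable {K : Type} [Field K] [NumberField K] [IsCMField K]

/-- **`L(θ_K‖·‖φ⁻¹, s) = L(θ_Kφ, s + 1)` for every `s`** (as Euler products, junk values included): for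
`θ_K` `c`-invariant (`θ_K ∘ c = θ_K`) and `φ ∘ c = φ⁻¹`, `reflect θ_K⁻¹ · φ⁻¹ = (θ_Kφ⁻¹)·‖·‖`
(`DeShalit1987.reflect_inv_of_galConj_eq`), `L((θ_Kφ⁻¹)‖·‖, s) = L(θ_Kφ⁻¹, s+1)` (norm shift) and
`θ_Kφ⁻¹ = (θ_Kφ) ∘ c` has the same `L`-function as `θ_Kφ` (`heckeLFunction_galConj`). This is the
"`L(θ_K ξ 𝐍_K, 0) = L(θ_K φ, 1)`, `ξ = φ^c`" line of the CGLS frame's docstring, in de Shalit's variables.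
[cite: deShalit1987, II.6.1 (1) and II.4.16 (50)] [cite: CastellaGrossiLeeSkinner2022, Thm. 2.1.2 (arXiv:2008.02571v2 TeX L1015–1041)] -/
theorem heckeLFunction_reflect_inv_mul_inv {θK φ : HeckeCharacter K}
    (hgal : HeckeCharacter.galConj (IsCMField.complexConj K) θK = θK)
    (hφ : HeckeCharacter.galConj (IsCMField.complexConj K) φ = φ⁻¹) (s : ℂ) :
    heckeLFunction (DeShalit1987.reflect θK⁻¹ * φ⁻¹) s = heckeLFunction (θK * φ) (s + 1) := by
  have hrefl : DeShalit1987.reflect θK⁻¹ = θK * normCharacter K :=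
    DeShalit1987.reflect_inv_of_galConj_eq hgal
  have heq : DeShalit1987.reflect θK⁻¹ * φ⁻¹ = (θK * φ⁻¹) * normCharacter K := by
    rw [hrefl, mul_right_comm]
  have hν : ∀ x : ideleGroup K,
      ((normCharacter K x : ℂˣ) : ℂ) = ((ideleNorm x : ℝ) : ℂ) ^ (1 : ℂ) := fun x ↦ by
    rw [Complex.cpow_one, normCharacter_apply]
  have hconj : HeckeCharacter.galConj (IsCMField.complexConj K) (θK * φ) = θK * φ⁻¹ := by
    rw [HeckeCharacter.galConj_mul, hgal, hφ]
  rw [heq, heckeLFunction_mul_eq_of_forall_apply_eq_cpow (θK * φ⁻¹) hν s, ← hconj,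
    heckeLFunction_galConj]

/-- **The CGLS continuation binder yields a de Shalit binder**: if `L(θ_Kφ, ·)` has an entire
continuation `g`, then `s ↦ g(s+1)` is an entire continuation of `L(θ_K‖·‖φ⁻¹, ·)`.
[cite: deShalit1987, II.4.16 (50)] [cite: CastellaGrossiLeeSkinner2022, Thm. 2.1.2] -/
theorem hasEntireContinuation_reflect_inv_mul_inv {θK φ : HeckeCharacter K}
    (hgal : HeckeCharacter.galConj (IsCMField.complexConj K) θK = θK)
    (hφ : HeckeCharacter.galConj (IsCMField.complexConj K) φ = φ⁻¹)
    (hL : LFunction.HasEntireContinuation (heckeLFunction (θK * φ))) :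
    LFunction.HasEntireContinuation (heckeLFunction (DeShalit1987.reflect θK⁻¹ * φ⁻¹)) := by
  refine ⟨fun s ↦ hL.continuation (s + 1),
    hL.differentiable_continuation.comp (differentiable_id.add_const 1), fun s hs ↦ ?_⟩
  show hL.continuation (s + 1) = heckeLFunction (DeShalit1987.reflect θK⁻¹ * φ⁻¹) s
  rw [heckeLFunction_reflect_inv_mul_inv hgal hφ s, hL.continuation_eq]
  rw [Complex.add_re, Complex.one_re]
  linarith

/-- **The de Shalit `L`-value IS the CGLS `L`-value**: for ANY entire continuation `hL'` of
`L(θ_K‖·‖φ⁻¹, ·)` and any entire continuation `hL` of `L(θ_Kφ, ·)`,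
`hL'.continuation 0 = hL.continuation 1` — `L(θ_K‖·‖φ⁻¹, 0) = L(θ_Kφ, 1)` (identity theorem: both
`hL'.continuation` and `s ↦ hL.continuation (s+1)` are entire and agree with the Euler product on `re s > 1`).
[cite: deShalit1987, II.4.16 (50)] [cite: CastellaGrossiLeeSkinner2022, Thm. 2.1.2] [cite: Kriz2016, Thm. 27 and §1 Notation (`𝐍_K`)] -/
theorem continuation_reflect_inv_mul_inv_zero {θK φ : HeckeCharacter K}
    (hgal : HeckeCharacter.galConj (IsCMField.complexConj K) θK = θK)
    (hφ : HeckeCharacter.galConj (IsCMField.complexConj K) φ = φ⁻¹)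
    (hL : LFunction.HasEntireContinuation (heckeLFunction (θK * φ)))
    (hL' : LFunction.HasEntireContinuation (heckeLFunction (DeShalit1987.reflect θK⁻¹ * φ⁻¹))) :
    hL'.continuation 0 = hL.continuation 1 := by
  have h := Hsieh2012.continuation_eq_of_differentiable hL' (g := fun s ↦ hL.continuation (s + 1))
    (hL.differentiable_continuation.comp (differentiable_id.add_const 1)) (fun s hs ↦ by
      show hL.continuation (s + 1) = heckeLFunction (DeShalit1987.reflect θK⁻¹ * φ⁻¹) s
      rw [heckeLFunction_reflect_inv_mul_inv hgal hφ s, hL.continuation_eq]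
      rw [Complex.add_re, Complex.one_re]
      linarith)
  have h0 := congrFun h 0
  simpa only [zero_add] using h0

end LValue

/-! ## §2 `φ ∘ c = φ⁻¹` for characters through an anticyclotomic `ℤ_p`-extension -/

section Anticyclotomic

variable {K : Type} [Field K] [NumberField K] [IsCMField K] {p : ℕ} [Fact p.Prime]

/-- **`φ ∘ c = φ⁻¹`** for an everywhere-unramified Hecke character `φ` of the imaginary quadratic
field `K` whose `p`-adic avatar factors through an ANTICYCLOTOMIC `ℤ_p`-extension `κ` — x11b's
`galConj_eq_inv_of_factorsThroughZp` (`χ ∘ c̄ = χ⁻¹` for `c ∈ Γ_ℚ ∖ Γ_K`) read through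
`c̄ = IsCMField.complexConj K` (`absGaloisQuot_eq_restrictScalars_complexConj`, `galConj_restrictScalars`).
This is the "`ξ = φ^c = φ⁻¹`" dictionary of the CGLS frame's docstring. [cite: Greenberg1987, §2] -/
theorem galConj_complexConj_eq_inv_of_factorsThroughZp (hK : IsImaginaryQuadratic K)
    (ι : PadicAlgCl p ≃+* ℂ) {κ : ZpExtension K p} (hκ : κ.IsAnticyclotomic)
    {φ : HeckeCharacter K} {r : FramedGaloisRep K (PadicAlgCl p) 1} (hr : IsPAdicAvatarOf ι φ r)
    (hκr : FactorsThroughZp κ r) (hφ : ∀ w : HeightOneSpectrum (𝓞 K), φ.IsUnramifiedAt w) :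
    HeckeCharacter.galConj (IsCMField.complexConj K) φ = φ⁻¹ := by
  haveI : Algebra.IsQuadraticExtension ℚ K := ⟨hK.1⟩
  haveI : IsGalois ℚ K := inferInstance
  haveI : IsTotallyComplex K := hK.2
  obtain ⟨c, hc, -⟩ := exists_not_mem_range_absGaloisRestrict K (Rat.castHom ℝ)
    (fun w ↦ IsTotallyComplex.isComplex w)
  have h := galConj_eq_inv_of_factorsThroughZp ι hκ hc hr hκr (fun v _ ↦ hφ v)
  rwa [absGaloisQuot_eq_restrictScalars_complexConj hK.1 hc, galConj_restrictScalars] at h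

end Anticyclotomic

/-! ## §3 The two primes above a split `p` of an imaginary quadratic field -/

section SplitPrimes

variable {K : Type} [Field K] [NumberField K]

/-- The place of `ℚ` below a prime of `K` containing the rational prime `p` is the place of `p`
(two places of `ℚ` containing `p` coincide). [folklore] -/
theorem under_rat_eq_of_natCast_mem {p : ℕ} (hp : p.Prime) {v w : HeightOneSpectrum (𝓞 K)}
    (hv : ((p : ℕ) : 𝓞 K) ∈ v.asIdeal) (hw : ((p : ℕ) : 𝓞 K) ∈ w.asIdeal) :
    v.under (𝓞 ℚ) = w.under (𝓞 ℚ) := by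
  have hmem : ∀ {u : HeightOneSpectrum (𝓞 K)}, ((p : ℕ) : 𝓞 K) ∈ u.asIdeal →
      ((p : ℕ) : 𝓞 ℚ) ∈ (u.under (𝓞 ℚ)).asIdeal := fun {u} hu ↦ by
    change ((p : ℕ) : 𝓞 ℚ) ∈ u.asIdeal.under (𝓞 ℚ)
    rw [Ideal.under_def, Ideal.mem_comap, map_natCast]
    exact hu
  exact HeightOneSpectrum.eq_of_natCast_mem_rat hp (hmem hv) (hmem hw)

variable [IsCMField K]

/-- **Complex conjugation swaps the two primes above a split rational prime** of an imaginary
quadratic field: if `v ≠ v̄` both contain `p` then `c • v = v̄` (`Gal(K/ℚ) = {1, c}` acts transitively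
on the primes above `p`, `HeightOneSpectrum.exists_algEquiv_smul_eq`, and `1` does not move `v`).
[cite: CasselsFrohlichANT1967, Ch. VII Prop. 1.2 (ii)] -/
theorem complexConj_smul_eq_of_ne (hK : IsImaginaryQuadratic K) {p : ℕ} (hp : p.Prime)
    {v vbar : HeightOneSpectrum (𝓞 K)} (hv : ((p : ℕ) : 𝓞 K) ∈ v.asIdeal)
    (hvbar : ((p : ℕ) : 𝓞 K) ∈ vbar.asIdeal) (hne : vbar ≠ v) :
    IsCMField.complexConj K • v = vbar := by
  haveI : Algebra.IsQuadraticExtension ℚ K := ⟨hK.1⟩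
  haveI : IsGalois ℚ K := inferInstance
  obtain ⟨σ, hσ⟩ := HeightOneSpectrum.exists_algEquiv_smul_eq (F := ℚ) (E := K)
    (under_rat_eq_of_natCast_mem hp hv hvbar)
  have hσ1 : σ ≠ 1 := by
    rintro rfl
    rw [one_smul] at hσ
    exact hne hσ.symm
  have hσc : σ = (IsCMField.complexConj K).restrictScalars ℚ :=
    algEquiv_eq_of_ne_one_of_finrank_eq_two hK.1 hσ1 restrictScalars_complexConj_ne_one
  rw [hσc] at hσ
  exact hσ

omit [IsCMField K] in
/-- **A prime above a split rational prime `p` of a quadratic field has norm `p`**: if `v ≠ v̄` both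
contain `p` then `N v = p` (the coprime ideals `v`, `v̄` both divide `(p)`, so `N v · N v̄ ∣ N((p)) = p²`
with both factors `> 1`). [cite: CasselsFrohlichANT1967, Ch. VII Prop. 1.2] -/
theorem absNorm_eq_of_natCast_mem_of_ne (h2 : Module.finrank ℚ K = 2) {p : ℕ} (hp : p.Prime)
    {v vbar : HeightOneSpectrum (𝓞 K)} (hv : ((p : ℕ) : 𝓞 K) ∈ v.asIdeal)
    (hvbar : ((p : ℕ) : 𝓞 K) ∈ vbar.asIdeal) (hne : vbar ≠ v) :
    Ideal.absNorm v.asIdeal = p := by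
  -- `v · v̄ ∣ (p)`
  have hcop : IsCoprime v.asIdeal vbar.asIdeal := Ideal.isCoprime_iff_sup_eq.mpr
    (v.isMaximal.coprime_of_ne vbar.isMaximal (fun h ↦ hne (HeightOneSpectrum.ext h.symm)))
  have hdvd : v.asIdeal * vbar.asIdeal ∣ Ideal.span {((p : ℕ) : 𝓞 K)} :=
    hcop.mul_dvd (Ideal.dvd_span_singleton.mpr hv) (Ideal.dvd_span_singleton.mpr hvbar)
  have hN : Ideal.absNorm (Ideal.span {((p : ℕ) : 𝓞 K)}) = p ^ 2 := by
    rw [Ideal.absNorm_span_singleton, show ((p : ℕ) : 𝓞 K) = algebraMap ℤ (𝓞 K) (p : ℤ) by simp,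
      Algebra.norm_algebraMap, NumberField.RingOfIntegers.rank, h2]
    simp [Int.natAbs_pow]
  have hdvd' : Ideal.absNorm v.asIdeal * Ideal.absNorm vbar.asIdeal ∣ p ^ 2 := by
    rw [← map_mul, ← hN]
    exact map_dvd Ideal.absNorm hdvd
  have hv1 : Ideal.absNorm v.asIdeal ≠ 1 := fun h ↦
    v.isPrime.ne_top (Ideal.absNorm_eq_one_iff.mp h)
  have hvbar1 : Ideal.absNorm vbar.asIdeal ≠ 1 := fun h ↦
    vbar.isPrime.ne_top (Ideal.absNorm_eq_one_iff.mp h)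
  obtain ⟨i, hi, hiv⟩ := (Nat.dvd_prime_pow hp).1 (dvd_trans (dvd_mul_right _ _) hdvd')
  obtain ⟨j, hj, hjv⟩ := (Nat.dvd_prime_pow hp).1 (dvd_trans (dvd_mul_left _ _) hdvd')
  rw [hiv, hjv, ← pow_add, Nat.pow_dvd_pow_iff_le_right hp.one_lt] at hdvd'
  have hi0 : i ≠ 0 := by rintro rfl; exact hv1 (by rw [hiv, pow_zero])
  have hj0 : j ≠ 0 := by rintro rfl; exact hvbar1 (by rw [hjv, pow_zero])
  have hi1 : i = 1 := by omega
  rw [hiv, hi1, pow_one]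

end SplitPrimes

/-! ## §4 THE FACTOR: CGLS's interpolation value at `φ` versus de Shalit's at `θ_K‖·‖φ⁻¹` -/

section Factor

variable {K : Type} [Field K] [NumberField K] [IsCMField K]

/-- The reflected twist evaluated: for `θ_K` `c`-invariant, `ε := reflect θ_K⁻¹ · φ⁻¹ = θ_K·‖·‖·φ⁻¹`.
[cite: deShalit1987, II.6.1 (1)] -/
theorem reflect_inv_mul_inv_eq {θK : HeckeCharacter K}
    (hgal : HeckeCharacter.galConj (IsCMField.complexConj K) θK = θK) (φ : HeckeCharacter K) :
    DeShalit1987.reflect θK⁻¹ * φ⁻¹ = θK * normCharacter K * φ⁻¹ := by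
  rw [DeShalit1987.reflect_inv_of_galConj_eq hgal]

/-- `ε = θ_K‖·‖φ⁻¹` is unramified wherever `θ_K` is (`φ` unramified everywhere, `‖·‖` unramified
everywhere). [cite: deShalit1987, II.6.1] -/
theorem isUnramifiedAt_reflect_inv_mul_inv {θK φ : HeckeCharacter K}
    (hgal : HeckeCharacter.galConj (IsCMField.complexConj K) θK = θK)
    (hφ : ∀ w : HeightOneSpectrum (𝓞 K), φ.IsUnramifiedAt w) {w : HeightOneSpectrum (𝓞 K)}
    (hw : θK.IsUnramifiedAt w) : (DeShalit1987.reflect θK⁻¹ * φ⁻¹).IsUnramifiedAt w := by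
  rw [reflect_inv_mul_inv_eq hgal]
  exact (hw.mul' (isUnramifiedAt_normCharacter' w)).mul' (hφ w).inv'

/-- `ε = θ_K‖·‖φ⁻¹` is ramified wherever `θ_K` is. [cite: deShalit1987, II.6.1] -/
theorem not_isUnramifiedAt_reflect_inv_mul_inv {θK φ : HeckeCharacter K}
    (hgal : HeckeCharacter.galConj (IsCMField.complexConj K) θK = θK)
    (hφ : ∀ w : HeightOneSpectrum (𝓞 K), φ.IsUnramifiedAt w) {w : HeightOneSpectrum (𝓞 K)}
    (hw : ¬ θK.IsUnramifiedAt w) : ¬ (DeShalit1987.reflect θK⁻¹ * φ⁻¹).IsUnramifiedAt w := by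
  intro h
  rw [reflect_inv_mul_inv_eq hgal] at h
  have h' := h.mul' ((hφ w).mul' (isUnramifiedAt_normCharacter' w).inv')
  have e : θK * normCharacter K * φ⁻¹ * (φ * (normCharacter K)⁻¹) = θK := by
    simp only [mul_assoc, inv_mul_cancel_left, mul_inv_cancel, mul_one]
  rw [e] at h'
  exact hw h'

/-- The value of `ε = θ_K‖·‖φ⁻¹` at a uniformiser of a place `w` of norm `N w` where `θ_K` is unramified:
`ε(ϖ_w) = θ_K(ϖ_w) · (N w)⁻¹ · φ(ϖ_w)⁻¹`. [cite: deShalit1987, II.6.1 (1)] -/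
theorem heckeValueExtZero_reflect_inv_mul_inv {θK φ : HeckeCharacter K}
    (hgal : HeckeCharacter.galConj (IsCMField.complexConj K) θK = θK)
    (hφ : ∀ w : HeightOneSpectrum (𝓞 K), φ.IsUnramifiedAt w) {w : HeightOneSpectrum (𝓞 K)}
    (hw : θK.IsUnramifiedAt w) :
    heckeValueExtZero (DeShalit1987.reflect θK⁻¹ * φ⁻¹) w =
      θK.valueAtUniformizer w * (((Ideal.absNorm w.asIdeal : ℕ) : ℂ))⁻¹ *
        (φ.valueAtUniformizer w)⁻¹ := by
  rw [heckeValueExtZero_of_isUnramifiedAt (isUnramifiedAt_reflect_inv_mul_inv hgal hφ hw),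
    reflect_inv_mul_inv_eq hgal, valueAtUniformizer_mul', valueAtUniformizer_mul',
    valueAtUniformizer_inv', valueAtUniformizer_normCharacter']

/-- `θ_K(ϖ_v̄) = θ_K(ϖ_v)` for `c`-invariant `θ_K` unramified at `v̄ = c • v`. [folklore] -/
theorem valueAtUniformizer_smul_of_galConj_eq {θK : HeckeCharacter K}
    (hgal : HeckeCharacter.galConj (IsCMField.complexConj K) θK = θK) {v : HeightOneSpectrum (𝓞 K)}
    (hv : θK.IsUnramifiedAt (IsCMField.complexConj K • v)) :
    θK.valueAtUniformizer (IsCMField.complexConj K • v) = θK.valueAtUniformizer v := by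
  rw [← valueAtUniformizer_galConj_of_isUnramifiedAt _ θK v hv, hgal]

/-- `φ(ϖ_v̄) = φ(ϖ_v)⁻¹` for `φ ∘ c = φ⁻¹` (`φ` unramified everywhere). [cite: Greenberg1987, §2] -/
theorem valueAtUniformizer_smul_of_galConj_eq_inv {φ : HeckeCharacter K}
    (hφc : HeckeCharacter.galConj (IsCMField.complexConj K) φ = φ⁻¹)
    (hφ : ∀ w : HeightOneSpectrum (𝓞 K), φ.IsUnramifiedAt w) (v : HeightOneSpectrum (𝓞 K)) :
    φ.valueAtUniformizer (IsCMField.complexConj K • v) = (φ.valueAtUniformizer v)⁻¹ := by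
  rw [← valueAtUniformizer_galConj_of_isUnramifiedAt _ φ v (hφ _), hφc, valueAtUniformizer_inv']

/-- **THE FACTOR.** For `K` imaginary quadratic with `p = v v̄` split, `θ_K` `c`-invariant and unramified
at `v, v̄` and RAMIFIED at every `w ∈ S` (`v̄ ∉ S`), `φ` unramified everywhere with `φ ∘ c = φ⁻¹`, `n ≥ 1`,
`δ ≠ 0` and any `Ω`, `L`:
`katzInterpolationValue p θ_K v v̄ ∅ φ n Ω L = 4 · ζ^{n−1} · interpolationValue p v v̄ S (reflect θ_K⁻¹·φ⁻¹) (n+1) (n−1) Ω δ L`,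
`ζ := (2πi/√D_K)/(2π/δ)`. Constituent by constituent (de Shalit II.4.16 (50) / Katz (5.3.5) against CGLS
Thm. 2.1.2 = Kriz Thm. 27): `Γ(n+1)` both; `(Ω^{2n})⁻¹` both; `(1 − ε(v)⁻¹p⁻¹) = (1 − θ(p)⁻¹φ(v)) =
(1 − θ(p)⁻¹φ(v̄)⁻¹)` (CGLS factor at `v`); removed Euler factors `(1 − ε(v̄))·∏_{w∈S} 1 =
(1 − θ(p)φ(v)p⁻¹)` (CGLS factor at `v̄`; `ε` is ramified on `S`); away factor at `Cbar = ∅` is `1`;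
`((2πi)/√D_K)^{n−1} = ζ^{n−1}(2π/δ)^{n−1}`; the constant `4`.
[cite: deShalit1987, II.4.16 (50) with II.4.14 (36) and II.6.1 (1)] [cite: Katz1978, Thm. (5.3.0) eq. (5.3.5)]
[cite: CastellaGrossiLeeSkinner2022, Thm. 2.1.2 (arXiv:2008.02571v2 TeX L1015–1041)] [cite: Kriz2016, Thm. 27] -/
theorem katzInterpolationValue_eq_mul_interpolationValue (hK : IsImaginaryQuadratic K) {p : ℕ}
    (hp : p.Prime) {v vbar : HeightOneSpectrum (𝓞 K)} (hv : ((p : ℕ) : 𝓞 K) ∈ v.asIdeal)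
    (hvbar : ((p : ℕ) : 𝓞 K) ∈ vbar.asIdeal) (hne : vbar ≠ v) {θK φ : HeckeCharacter K}
    (hgal : HeckeCharacter.galConj (IsCMField.complexConj K) θK = θK) (hθv : θK.IsUnramifiedAt v)
    (hθvbar : θK.IsUnramifiedAt vbar)
    (hφc : HeckeCharacter.galConj (IsCMField.complexConj K) φ = φ⁻¹)
    (hφ : ∀ w : HeightOneSpectrum (𝓞 K), φ.IsUnramifiedAt w)
    {S : Finset (HeightOneSpectrum (𝓞 K))} (hS : ∀ w ∈ S, ¬ θK.IsUnramifiedAt w) (hvbarS : vbar ∉ S)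
    {n : ℕ} (hn : 1 ≤ n) (Ω : ℂ) {δ : ℂ} (hδ : δ ≠ 0) (Lval : ℂ) :
    katzInterpolationValue p θK v vbar ∅ φ n Ω Lval =
      4 * ((2 * (Real.pi : ℂ) * Complex.I / ((NumberField.discr K : ℂ) ^ ((2 : ℂ)⁻¹))) /
            (2 * (Real.pi : ℂ) / δ)) ^ (n - 1) *
        DeShalit1987.interpolationValue p v vbar S (DeShalit1987.reflect θK⁻¹ * φ⁻¹) (n + 1) (n - 1)
          Ω δ Lval := by
  -- names for the atoms
  set a : ℂ := θK.valueAtUniformizer v with ha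
  set b : ℂ := φ.valueAtUniformizer v with hb
  set A : ℂ := 2 * (Real.pi : ℂ) / δ with hA
  set B : ℂ := 2 * (Real.pi : ℂ) * Complex.I / ((NumberField.discr K : ℂ) ^ ((2 : ℂ)⁻¹)) with hB
  have hp0 : (p : ℂ) ≠ 0 := Nat.cast_ne_zero.mpr hp.ne_zero
  have hA0 : A ≠ 0 := by
    rw [hA]
    exact div_ne_zero (mul_ne_zero two_ne_zero (Complex.ofReal_ne_zero.mpr Real.pi_ne_zero)) hδ
  -- the two primes above `p`
  have hcv : IsCMField.complexConj K • v = vbar := complexConj_smul_eq_of_ne hK hp hv hvbar hne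
  have hNv : Ideal.absNorm v.asIdeal = p := absNorm_eq_of_natCast_mem_of_ne hK.1 hp hv hvbar hne
  have hNvbar : Ideal.absNorm vbar.asIdeal = p :=
    absNorm_eq_of_natCast_mem_of_ne hK.1 hp hvbar hv hne.symm
  -- values of `θ_K`, `φ`, `ε` at `v` and `v̄`
  have hθvbar_val : θK.valueAtUniformizer vbar = a := by
    rw [← hcv]; exact valueAtUniformizer_smul_of_galConj_eq hgal (by rw [hcv]; exact hθvbar)
  have hφvbar_val : φ.valueAtUniformizer vbar = b⁻¹ := by
    rw [← hcv]; exact valueAtUniformizer_smul_of_galConj_eq_inv hφc hφ v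
  have hεv : heckeValueExtZero (DeShalit1987.reflect θK⁻¹ * φ⁻¹) v = a * ((p : ℂ))⁻¹ * b⁻¹ := by
    rw [heckeValueExtZero_reflect_inv_mul_inv hgal hφ hθv, hNv]
  have hεvbar : heckeValueExtZero (DeShalit1987.reflect θK⁻¹ * φ⁻¹) vbar = a * ((p : ℂ))⁻¹ * b := by
    rw [heckeValueExtZero_reflect_inv_mul_inv hgal hφ hθvbar, hNvbar, hθvbar_val, hφvbar_val, inv_inv]
  have hθv_val : heckeValueExtZero θK v = a := heckeValueExtZero_of_isUnramifiedAt hθv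
  have hφv_val : heckeValueExtZero φ v = b := heckeValueExtZero_of_isUnramifiedAt (hφ v)
  have hφvbar_val' : heckeValueExtZero φ vbar = b⁻¹ := by
    rw [heckeValueExtZero_of_isUnramifiedAt (hφ vbar), hφvbar_val]
  -- the removed Euler factors: `ε` is ramified on `S`
  have hrem : DeShalit1987.removedEulerFactorsAtZero (DeShalit1987.reflect θK⁻¹ * φ⁻¹) (insert vbar S) =
      1 - a * ((p : ℂ))⁻¹ * b := by
    rw [DeShalit1987.removedEulerFactorsAtZero_insert _ hvbarS, hεvbar]
    have h1 : DeShalit1987.removedEulerFactorsAtZero (DeShalit1987.reflect θK⁻¹ * φ⁻¹) S = 1 := by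
      unfold DeShalit1987.removedEulerFactorsAtZero
      refine Finset.prod_eq_one fun w hw ↦ ?_
      rw [heckeValueExtZero_of_not_isUnramifiedAt (not_isUnramifiedAt_reflect_inv_mul_inv hgal hφ (hS w hw)),
        sub_zero]
    rw [h1, mul_one]
  -- the away factor at `Cbar = ∅` and the archimedean factors
  have haway : katzAwayFactor θK φ ∅ = 1 := katzAwayFactor_eq_one_of_forall_not_isUnramifiedAt φ (by simp)
  have hΓ : DeShalit1987.gammaFactorAtZero (n + 1) = Complex.Gamma ((n : ℂ) + 1) := by
    unfold DeShalit1987.gammaFactorAtZero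
    push_cast
    rfl
  have hmj : n + 1 + (n - 1) = 2 * n := by omega
  have hBA : (B / A) ^ (n - 1) * A ^ (n - 1) = B ^ (n - 1) := by
    rw [div_pow, div_mul_cancel₀ _ (pow_ne_zero _ hA0)]
  -- assemble
  unfold katzInterpolationValue DeShalit1987.interpolationValue
  rw [hθv_val, hφv_val, hφvbar_val', hεv, hrem, haway, hΓ, hmj, ← hB, ← hA, ← hBA]
  field_simp

end Factor

end Summit.BirchSwinnertonDyer.BirchSwinnertonDyer.Theorems.KatzLineFrame

end
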